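import Literature.Analysis.FluidPDE.ForwardDSSExistence
import Literature.Analysis.FluidPDE.ForwardDSSExtension
import HarnessLib

/-!
# Forward DSS solutions: Theorem 1.2 of Bradshaw–Tsai 2019 from the unit cylinder

Analysis/FluidPDE fact file, companion of `ForwardDSSExistence.lean` and
`ForwardDSSExtension.lean`. The former renders the conclusion of Bradshaw–Tsai, *Discretely
self-similar solutions to the Navier–Stokes equations with data in `L²_loc` satisfying the local
energy inequality*, Analysis & PDE 12 (2019) = arXiv:1801.08060, **Theorem 1.2** as the predicate
`IsBradshawTsai2019Solution c v₀ v π` and vendors the printed proof's ingredients as the named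
facts `bradshawTsai2019_lemma_4_1` (Lemma 4.1), `bradshawTsai2017_dss_localLeray_existence` ([BT1]
Thm 1.2), `bradshawTsai2019_prop_3_1` (Prop. 3.1) and `bradshawTsai2019_limit_4_3` (§4.3 with §4.2,
conclusion = the *global* `IsBradshawTsai2019Solution`), with the proved assembly
`bradshawTsai2019_dss_existence_of_parts`; the latter **proves the re-scaling argument** of
§4.2–§4.3 (`BradshawTsai2019.extension`: a `λ`-DSS pair which is a suitable weak solution on the
unit cylinder `(0, T) × B₁` with the classes of Prop. 3.1 there and attaining its datum on compact
subsets of `B₁` satisfies the full conclusion of Theorem 1.2).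

This file puts the two together and **localizes the remaining debt** of Theorem 1.2:

* `IsBradshawTsai2019LocalSolution c v₀ v π T` — the conclusion of Theorem 1.2 *on the unit forward
  cylinder* for a pair that is `λ`-DSS on `ℝ × ℝ³`, velocity **and** pressure (exactly the
  hypotheses of `BradshawTsai2019.extension` on the pair), and the proved
  `IsBradshawTsai2019Solution.of_local` (= `BradshawTsai2019.extension` for `E = ℝ³`,
  `Q₀ = timeCylinder unitBall 0 T`);
* `bradshawTsai2019_limit_4_3_local` (named fact, **not proved**): the hypotheses of
  `bradshawTsai2019_limit_4_3` **plus** "the approximating pressures `π_k` are `λ`-DSS", with the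
  *local* conclusion `∃ v π, IsBradshawTsai2019LocalSolution c v₀ v π T`, and the proved
  `bradshawTsai2019_limit_4_3_of_local` (the global conclusion under the same extra hypothesis);
* `bradshawTsai2019_prop_3_1_dss` (named fact, **not proved**): `bradshawTsai2019_prop_3_1` with the
  clause that the associated (normalised) pressure is `λ`-DSS, and its projection
  `bradshawTsai2019_prop_3_1_dss.prop_3_1` onto the accepted fact;
* `bradshawTsai2019_dss_existence_of_local_parts` (**proved**): `bradshawTsai2019_lemma_4_1`,
  `bradshawTsai2019_prop_3_1_dss` and `bradshawTsai2019_limit_4_3_local` imply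
  `bradshawTsai2019_dss_existence` (the bookkeeping of `bradshawTsai2019_dss_existence_of_parts`),
  hence the historical `chae_wolf_dss_existence` and `chaeWolf2018_dss_existence`
  (`SelfSimilarLiouville.lean`). In this trust base the re-scaling argument is *proved*; the price
  is the DSS invariance of the [BT1] pressures, which in print is the pressure formula (3.3).

## Why the pressures are assumed DSS

The re-scaling argument transports *suitability*, which involves the pressure, so it needs the pair
`(v, π)` — not only `v` — to be invariant under the scaling (hypotheses `hu`, `hp` of
`BradshawTsai2019.extension`). In print this is supplied by the pressure formula: the pressure
associated with a [BT1] solution is normalised in the proof of Prop. 3.1 (arXiv p. 9: "Up to a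
function `π_*(t)` independent of `x`, `π_ε(x,t) − π_*(t) = −⅓[(η_{ε√t} * v_ε)·v_ε](x,t) +
lim_{δ→0} ∫_{|y|>δ} K_{ij}(x−y)(η_{ε√t} * v_ε)_i (v_ε)_j(y,t) dy` [...] we can re-define `π_ε` to
equal `π_ε − π_*(t)`"), a formula covariant under the DSS scaling (the mollification `η_{ε√t}`
scales with it), and Prop. 3.1 asserts the limiting formula (3.3); §4.3 uses it ("note that `π_k`
satisfies the formula (3.3). Applying Lemma 2.1 to the above sequence and limit implies that `π`
satisfies the desired pressure formula", arXiv p. 13) to identify the limit pressure. The accepted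
renderings `bradshawTsai2019_prop_3_1` / `bradshawTsai2019_limit_4_3` omit (3.3) and with it the
DSS invariance of the pressures; the facts below restore exactly that invariance (not the
formula). With it the limit pressure is `λ`-DSS as well (weak limits of `λ`-DSS functions along the
scaling orbit of the unit cylinder), which is what `IsBradshawTsai2019LocalSolution` records.

Rendering conventions are those of `IsBradshawTsai2019Solution` (module docstrings of
`ForwardDSSExistence` and `SelfSimilarLiouville`, "Forward DSS existence"): DSS identities pointwise
on `ℝ × ℝ³`, `∀ᵐ t` sliced energy bounds, datum along `𝓝[>] 0`, weak gradients as
`HasWeakSpatialGradientOn` witnesses.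

## References

* Z. Bradshaw, T.-P. Tsai, Analysis & PDE 12 (2019) 1943–1962 = arXiv:1801.08060: Thm 1.2 (p. 4),
  Lemma 2.1 (p. 6), Prop. 3.1 with (3.3) and its proof (pp. 8–10), §4.2 (pp. 11–12), §4.3
  (pp. 12–13) [BradshawTsai2019].
* Z. Bradshaw, T.-P. Tsai, Ann. Henri Poincaré 18 (2017) = arXiv:1510.07504, Def. 1.1, Thm 1.2
  [BradshawTsai2017AHP].
-/

noncomputable section

open MeasureTheory TopologicalSpace Set Function Filter Metric Module
open scoped InnerProductSpace RealInnerProductSpace ENNReal NNReal Topology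

namespace Literature.Analysis.FluidPDE

/-- Local notation for physical space `ℝ³ = EuclideanSpace ℝ (Fin 3)`. -/
local notation "ℝ³" => EuclideanSpace ℝ (Fin 3)

/-! ## The conclusion of Theorem 1.2 on the unit cylinder -/

/-- **The conclusion of Bradshaw–Tsai 2019, Thm 1.2, on the unit forward cylinder** — the data
produced in §4.3 of arXiv:1801.08060 (p. 12) *before* its closing re-scaling argument, for the
scaling factor `c`, the datum `v₀`, a pair `(v, π)` and a height `T` (in print
`T = T(‖v₀‖²_{L²(B_λ)}, λ)` of Prop. 3.1): `v` is `c`-DSS and `π` is a `c`-DSS pressure on `ℝ × ℝ³`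
(§4.3: the limit "can be extended to a DSS solution on `ℝ³ × (0, ∞)`" by §4.2, the pressure with
it by the DSS-covariant formula (3.3) / Lemma 2.1 — module docstring, "Why the pressures are
assumed DSS"); `(v, π)` is a suitable weak solution (`ν = 1`, `f = 0`, CKN) on
`(0, T) × B₁ = timeCylinder unitBall 0 T` (§4.3: `v_k → v` weakly in `L²(0,T;H¹(B₁))`, strongly in
`L²`, `π_k ⇀ π` in `L^{3/2}`, and "the local energy inequality for `v` plainly follows" by lower
semicontinuity); the classes `v ∈ L^∞(0,T; L²(B₁))` (an `∀ᵐ t` bound), `∇v ∈ L²((0,T) × B₁)` for a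
weak spatial gradient on the cylinder and `π ∈ L^{3/2}((0,T) × B₁)` (the bounds (3.1)–(3.2) of
Prop. 3.1 passed to the limit); and `∫_K ‖v(t) − v₀‖² → 0` as `t → 0⁺` for every compact `K ⊆ B₁`
("For compact subsets `K` of `B₁`, we automatically have `lim_{t→0⁺} ‖v − v₀‖_{L²(K)} = 0`"). The
clauses are, in order, the hypotheses `hu`, `hp`, `hsuit`, `hen`, `hgrad`, `hpress`, `hdatum` of
`BradshawTsai2019.extension`, which upgrades them to `IsBradshawTsai2019Solution`
(`IsBradshawTsai2019Solution.of_local`). [cite: BradshawTsai2019, §4.3 (proof of Thm 1.2)] -/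
def IsBradshawTsai2019LocalSolution (c : ℝ) (v₀ : ℝ³ → ℝ³) (v : ℝ → ℝ³ → ℝ³) (π : ℝ → ℝ³ → ℝ)
    (T : ℝ) : Prop :=
  IsDiscretelySelfSimilar c v ∧ nsRescalePressure c π = π ∧
  IsSuitableWeakSolutionOn (timeCylinder unitBall 0 T) 1 0 v π ∧
  (∃ C₀ : ℝ≥0, ∀ᵐ t ∂(volume.restrict (Ioo 0 T)), ∫⁻ x in ball (0 : ℝ³) 1, ‖v t x‖ₑ ^ 2 ≤ C₀) ∧
  (∃ G₀ : ℝ → ℝ³ → ℝ³ →L[ℝ] ℝ³, HasWeakSpatialGradientOn (timeCylinder unitBall 0 T) v G₀ ∧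
    ∫⁻ z in Ioo 0 T ×ˢ ball (0 : ℝ³) 1, ENNReal.ofReal (frobeniusNormSq (G₀ z.1 z.2)) < ⊤) ∧
  ∫⁻ z in Ioo 0 T ×ˢ ball (0 : ℝ³) 1, ‖π z.1 z.2‖ₑ ^ (3 / 2 : ℝ) < ⊤ ∧
  ∀ K : Set ℝ³, IsCompact K → K ⊆ ball 0 1 →
    Tendsto (fun t => ∫⁻ x in K, ‖v t x - v₀ x‖ₑ ^ 2) (𝓝[>] 0) (𝓝 0)

/-- **The re-scaling argument** (Bradshaw–Tsai 2019, end of §4.3; proved in the tree as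
`BradshawTsai2019.extension`, `ForwardDSSExtension.lean`): for `λ > 1`, `T > 0` and a measurable
`λ`-DSS datum, the conclusion of Theorem 1.2 on the unit cylinder implies the full conclusion
`IsBradshawTsai2019Solution`. [cite: BradshawTsai2019, §4.3 (proof of Thm 1.2)] -/
theorem IsBradshawTsai2019Solution.of_local {c : ℝ} (hc : 1 < c) {T : ℝ} (hT : 0 < T)
    {v₀ : ℝ³ → ℝ³} {v : ℝ → ℝ³ → ℝ³} {π : ℝ → ℝ³ → ℝ} (hm₀ : AEStronglyMeasurable v₀ volume)
    (hdss₀ : nsRescaleData c v₀ = v₀) (h : IsBradshawTsai2019LocalSolution c v₀ v π T) :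
    IsBradshawTsai2019Solution c v₀ v π := by
  obtain ⟨hu, hp, hsuit, ⟨C₀, hen⟩, hgrad, hpress, hdatum⟩ := h
  exact BradshawTsai2019.extension hc hm₀ hdss₀ hu hp hT (Q₀ := timeCylinder unitBall 0 T) rfl
    hsuit hen hgrad hpress hdatum

/-! ## The localized facts -/

/-- **Bradshaw–Tsai 2019, Proposition 3.1, with the DSS invariance of the pressure**
(arXiv:1801.08060, p. 8; the accepted rendering `bradshawTsai2019_prop_3_1`, quoted there
verbatim, plus one clause). Prop. 3.1 concludes "Moreover, for `x ∈ B₁` and `t ∈ (0, T)`, the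
pressure satisfies the formula (3.3) `π(x,t) = −⅓|v|²(x,t) +
lim_{δ→0} ∫_{|y|>δ} K_{ij}(x−y) v_i(y,t) v_j(y,t) dy` in `L^{3/2}(B₁ × (0,T))`", for the associated
pressure of the [BT1] solution normalised in its proof (p. 9: "we can re-define `π_ε` to equal
`π_ε − π_*(t)`", after which `π_ε` is given globally by the DSS-covariant formula and
`π = lim π_ε`); §4.3 (p. 13) uses that "`π_k` satisfies the formula (3.3)" (hypothesis of Lemma 2.1,
stated for all `x`). The covariance of the formula under `v ↦ λv(λ²t, λx)` makes this pressure a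
`λ`-DSS pressure, `λ²π(λ²t, λx) = π(t, x)` — the clause added here (`nsRescalePressure c π = π`);
the formula itself stays omitted. Everything else — the existential/uniform reading
`∀ M, ∃ T C, ∀ v₀` with `‖v₀‖²_{L²(B_λ)} ≤ M` (module docstring of `ForwardDSSExistence`, "Prop.
3.1"), the bounds (3.1)–(3.2) on `(0, T) × B₁` — is as in `bradshawTsai2019_prop_3_1`, onto which
this fact projects (`bradshawTsai2019_prop_3_1_dss.prop_3_1`). **Not proved here.** [cite: BradshawTsai2019, Prop 3.1 with (3.3)] -/
def bradshawTsai2019_prop_3_1_dss : Prop :=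
  ∀ {c : ℝ}, 1 < c → ∀ M : ℝ≥0, ∃ T : ℝ, 0 < T ∧ ∃ C : ℝ≥0, ∀ {v₀ : ℝ³ → ℝ³},
    FunctionSpaces.MemWeakLp v₀ 3 volume → IsWeaklyDivFree v₀ →
      nsRescaleData c v₀ = v₀ → ∫⁻ x in ball (0 : ℝ³) c, ‖v₀ x‖ₑ ^ 2 ≤ M →
    ∃ (v : ℝ → ℝ³ → ℝ³) (π : ℝ → ℝ³ → ℝ),
      IsLocalLeraySolution 1 v₀ v π ∧ IsDiscretelySelfSimilar c v ∧
      nsRescalePressure c π = π ∧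
      (∀ᵐ t ∂(volume.restrict (Ioo 0 T)), ∫⁻ x in ball (0 : ℝ³) 1, ‖v t x‖ₑ ^ 2 ≤ C) ∧
      (∃ G : ℝ → ℝ³ → ℝ³ →L[ℝ] ℝ³,
        HasWeakSpatialGradientOn (slab ℝ³ (Ioi 0) isOpen_Ioi) v G ∧
        ∫⁻ z in Ioo 0 T ×ˢ ball (0 : ℝ³) 1,
          ENNReal.ofReal (frobeniusNormSq (G z.1 z.2)) ≤ C) ∧
      ∫⁻ z in Ioo 0 T ×ˢ ball (0 : ℝ³) 1, ‖π z.1 z.2‖ₑ ^ (3 / 2 : ℝ) ≤ C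

/-- `bradshawTsai2019_prop_3_1_dss` projects onto the accepted `bradshawTsai2019_prop_3_1`
(forget the DSS invariance of the pressure). [cite: BradshawTsai2019, Prop 3.1] -/
theorem bradshawTsai2019_prop_3_1_dss.prop_3_1 (h : bradshawTsai2019_prop_3_1_dss) :
    bradshawTsai2019_prop_3_1 := by
  intro c hc M
  obtain ⟨T, hT, C, hTC⟩ := h hc M
  refine ⟨T, hT, C, fun hw hdiv hdss hM => ?_⟩
  obtain ⟨v, π, hv, hdssv, -, hrest⟩ := hTC hw hdiv hdss hM
  exact ⟨v, π, hv, hdssv, hrest⟩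

/-- **Bradshaw–Tsai 2019, §4.3: the passage to the limit, localized** (arXiv:1801.08060, p. 12;
the statement established there *before* the re-scaling argument; cf. the accepted
`bradshawTsai2019_limit_4_3` for the verbatim quotation and the global rendering). Hypotheses:
those of `bradshawTsai2019_limit_4_3`, in the same order — `λ > 1`; `v₀ ∈ L²_loc` divergence free
`λ`-DSS; data `w₀⁽ᵏ⁾ ∈ L³_w`, divergence free, `λ`-DSS, `‖w₀⁽ᵏ⁾ − v₀‖_{L²(B₁)} → 0`; `λ`-DSS local Leray
solutions `(v_k, π_k)` with data `w₀⁽ᵏ⁾` obeying the bounds of Prop. 3.1 on `(0, T) × B₁` uniformly in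
`k` — **and in addition** (inserted after the DSS hypothesis on the `v_k`) that the pressures `π_k`
are `λ`-DSS, as the normalised [BT1] pressures are (`bradshawTsai2019_prop_3_1_dss`; module
docstring, "Why the pressures are assumed DSS"). Conclusion: a pair `(v, π)` with
`IsBradshawTsai2019LocalSolution c v₀ v π T` ("As usual (cf. [BT1, KiSe, LR2]), there exists a
distribution `v` and a subsequence [...] so that `v_k` converges to `v` in the weak star topology
on `L^∞(0,T;L²(B₁))`, in the weak topology on `L²(0,T;H¹(B₁))`, and in `L²(0,T;L²(B₁))` [...] we
may extract a subsequence [of `π_k`] which converges weakly to a distribution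
`π ∈ L^{3/2}(0,T;L^{3/2}(B₁))` [...] `v` can be extended to a DSS solution on `ℝ³ × (0,∞)` [...]
For compact subsets `K` of `B₁`, we automatically have `lim_{t→0⁺} ‖v − v₀‖_{L²(K)} = 0` [...] The
local energy inequality for `v` plainly follows"). `bradshawTsai2019_limit_4_3_of_local` upgrades
the conclusion to `IsBradshawTsai2019Solution`. **Not proved here** (compactness on the
cylinders, lower semicontinuity of the local energy inequality [CKN], the datum via the local
energy inequality up to `t = 0`). [cite: BradshawTsai2019, §4.3 (proof of Thm 1.2) with §4.2] -/
def bradshawTsai2019_limit_4_3_local : Prop :=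
  ∀ {c : ℝ}, 1 < c → ∀ {v₀ : ℝ³ → ℝ³}, AEStronglyMeasurable v₀ volume →
    LocallyIntegrable (fun x => ‖v₀ x‖ ^ 2) volume → IsWeaklyDivFree v₀ →
      nsRescaleData c v₀ = v₀ →
    ∀ {w₀ : ℕ → ℝ³ → ℝ³} {v : ℕ → ℝ → ℝ³ → ℝ³} {π : ℕ → ℝ → ℝ³ → ℝ} {T : ℝ} {C : ℝ≥0},
    (∀ k, FunctionSpaces.MemWeakLp (w₀ k) 3 volume) → (∀ k, IsWeaklyDivFree (w₀ k)) →
    (∀ k, nsRescaleData c (w₀ k) = w₀ k) →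
    Tendsto (fun k => ∫⁻ x in ball (0 : ℝ³) 1, ‖w₀ k x - v₀ x‖ₑ ^ 2) atTop (𝓝 0) →
    (∀ k, IsLocalLeraySolution 1 (w₀ k) (v k) (π k)) →
    (∀ k, IsDiscretelySelfSimilar c (v k)) →
    (∀ k, nsRescalePressure c (π k) = π k) →
    0 < T →
    (∀ k, ∀ᵐ t ∂(volume.restrict (Ioo 0 T)), ∫⁻ x in ball (0 : ℝ³) 1, ‖v k t x‖ₑ ^ 2 ≤ C) →
    (∀ k, ∃ G : ℝ → ℝ³ → ℝ³ →L[ℝ] ℝ³,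
      HasWeakSpatialGradientOn (slab ℝ³ (Ioi 0) isOpen_Ioi) (v k) G ∧
      ∫⁻ z in Ioo 0 T ×ˢ ball (0 : ℝ³) 1,
        ENNReal.ofReal (frobeniusNormSq (G z.1 z.2)) ≤ C) →
    (∀ k, ∫⁻ z in Ioo 0 T ×ˢ ball (0 : ℝ³) 1, ‖π k z.1 z.2‖ₑ ^ (3 / 2 : ℝ) ≤ C) →
    ∃ (u : ℝ → ℝ³ → ℝ³) (p : ℝ → ℝ³ → ℝ), IsBradshawTsai2019LocalSolution c v₀ u p T

/-- **The localized limit fact yields the global one** (under the DSS invariance of the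
approximating pressures): the conclusion of `bradshawTsai2019_limit_4_3` for data, solutions and
pressures as in `bradshawTsai2019_limit_4_3_local`, by `IsBradshawTsai2019Solution.of_local` — the
re-scaling argument of §4.3 is thereby proved rather than assumed. [cite: BradshawTsai2019, §4.3 (proof of Thm 1.2)] -/
theorem bradshawTsai2019_limit_4_3_of_local (h : bradshawTsai2019_limit_4_3_local) {c : ℝ}
    (hc : 1 < c) {v₀ : ℝ³ → ℝ³} (hm₀ : AEStronglyMeasurable v₀ volume)
    (hL2 : LocallyIntegrable (fun x => ‖v₀ x‖ ^ 2) volume) (hdiv : IsWeaklyDivFree v₀)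
    (hdss₀ : nsRescaleData c v₀ = v₀)
    {w₀ : ℕ → ℝ³ → ℝ³} {v : ℕ → ℝ → ℝ³ → ℝ³} {π : ℕ → ℝ → ℝ³ → ℝ} {T : ℝ} {C : ℝ≥0}
    (hw : ∀ k, FunctionSpaces.MemWeakLp (w₀ k) 3 volume) (hwdiv : ∀ k, IsWeaklyDivFree (w₀ k))
    (hwdss : ∀ k, nsRescaleData c (w₀ k) = w₀ k)
    (hconv : Tendsto (fun k => ∫⁻ x in ball (0 : ℝ³) 1, ‖w₀ k x - v₀ x‖ₑ ^ 2) atTop (𝓝 0))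
    (hLL : ∀ k, IsLocalLeraySolution 1 (w₀ k) (v k) (π k))
    (hvdss : ∀ k, IsDiscretelySelfSimilar c (v k)) (hπdss : ∀ k, nsRescalePressure c (π k) = π k)
    (hT : 0 < T)
    (hE : ∀ k, ∀ᵐ t ∂(volume.restrict (Ioo 0 T)), ∫⁻ x in ball (0 : ℝ³) 1, ‖v k t x‖ₑ ^ 2 ≤ C)
    (hG : ∀ k, ∃ G : ℝ → ℝ³ → ℝ³ →L[ℝ] ℝ³,
      HasWeakSpatialGradientOn (slab ℝ³ (Ioi 0) isOpen_Ioi) (v k) G ∧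
      ∫⁻ z in Ioo 0 T ×ˢ ball (0 : ℝ³) 1, ENNReal.ofReal (frobeniusNormSq (G z.1 z.2)) ≤ C)
    (hP : ∀ k, ∫⁻ z in Ioo 0 T ×ˢ ball (0 : ℝ³) 1, ‖π k z.1 z.2‖ₑ ^ (3 / 2 : ℝ) ≤ C) :
    ∃ (u : ℝ → ℝ³ → ℝ³) (p : ℝ → ℝ³ → ℝ), IsBradshawTsai2019Solution c v₀ u p := by
  obtain ⟨u, p, hloc⟩ := h hc hm₀ hL2 hdiv hdss₀ hw hwdiv hwdss hconv hLL hvdss hπdss hT hE hG hP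
  exact ⟨u, p, IsBradshawTsai2019Solution.of_local hc hT hm₀ hdss₀ hloc⟩

/-! ## The assembly from the localized facts -/

/-- **Assembly of Bradshaw–Tsai 2019, Theorem 1.2, from the localized ingredients** (§4.3,
arXiv:1801.08060 p. 12): Lemma 4.1, Prop. 3.1 over [BT1] with `λ`-DSS pressures, and the passage
to the limit on the unit cylinder imply `bradshawTsai2019_dss_existence`; the extension to
`ℝ³ × (0, ∞)` and the classes on every `(0, T') × K` are the proved re-scaling argument.
Bookkeeping as in `bradshawTsai2019_dss_existence_of_parts`: take the `L³_w` approximants `φ⁽ᵏ⁾` of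
Lemma 4.1, drop finitely many so that `‖φ⁽ᵏ⁾ − v₀‖²_{L²(B₁)} ≤ 1`, whence
`‖φ⁽ᵏ⁾‖²_{L²(B_λ)} ≤ λ(2 + 2‖v₀‖²_{L²(B₁)}) =: M` uniformly
(`BradshawTsai2019.setLIntegral_ball_enorm_sq_of_nsRescaleData`); Prop. 3.1 gives `T`, `C` and the
solutions `(v_k, π_k)`; pass to the limit. Compared with the trust base
`{bradshawTsai2019_lemma_4_1, bradshawTsai2019_prop_3_1, bradshawTsai2019_limit_4_3}` of
`bradshawTsai2019_dss_existence_of_parts`, the limit fact is only asked for on the unit cylinder. [cite: BradshawTsai2019, §4.3 (proof of Thm 1.2)] -/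
theorem bradshawTsai2019_dss_existence_of_local_parts (h41 : bradshawTsai2019_lemma_4_1)
    (h31 : bradshawTsai2019_prop_3_1_dss) (h43 : bradshawTsai2019_limit_4_3_local) :
    bradshawTsai2019_dss_existence := by
  intro c hc u₀ hmeas hL2 hdiv hdss
  obtain ⟨φ, hφw, hφdiv, hφdss, hφlim⟩ := h41 hc hmeas hL2 hdiv hdss
  have hc0 : 0 < c := zero_lt_one.trans hc
  -- finiteness of the `L²(B₁)`-mass of the datum
  have hI₀ : ∫⁻ x in ball (0 : ℝ³) 1, ‖u₀ x‖ₑ ^ 2 < ⊤ :=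
    BradshawTsai2019.setLIntegral_ball_enorm_sq_lt_top hL2 1
  -- drop finitely many terms: eventually `∫_{B₁} ‖φ k − u₀‖² ≤ 1`
  obtain ⟨N, hN⟩ : ∃ N, ∀ k ≥ N, ∫⁻ x in ball (0 : ℝ³) 1, ‖φ k x - u₀ x‖ₑ ^ 2 ≤ 1 :=
    eventually_atTop.1 (hφlim.eventually_mem (Iic_mem_nhds zero_lt_one))
  -- the uniform bound on `B_c` via the DSS scaling law
  have hbound : ∀ k, ∫⁻ x in ball (0 : ℝ³) c, ‖φ (k + N) x‖ₑ ^ 2 ≤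
      ENNReal.ofReal c * (2 * 1 + 2 * ∫⁻ x in ball (0 : ℝ³) 1, ‖u₀ x‖ₑ ^ 2) := by
    intro k
    have h1 : ∫⁻ x in ball (0 : ℝ³) 1, ‖φ (k + N) x‖ₑ ^ 2 ≤
        2 * 1 + 2 * ∫⁻ x in ball (0 : ℝ³) 1, ‖u₀ x‖ₑ ^ 2 :=
      (BradshawTsai2019.setLIntegral_enorm_sq_le_two_mul _ (hφw _).aestronglyMeasurable
        hmeas).trans (add_le_add (mul_le_mul_right (hN _ (N.le_add_left k)) 2) le_rfl)
    have h2 := BradshawTsai2019.setLIntegral_ball_enorm_sq_of_nsRescaleData hc0 (hφdss (k + N)) 1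
    rw [mul_one] at h2
    rw [h2]
    exact mul_le_mul_right h1 _
  have hMfin : ENNReal.ofReal c * (2 * 1 + 2 * ∫⁻ x in ball (0 : ℝ³) 1, ‖u₀ x‖ₑ ^ 2) ≠ ⊤ :=
    ENNReal.mul_ne_top ENNReal.ofReal_ne_top (ENNReal.add_ne_top.2
      ⟨ENNReal.mul_ne_top ENNReal.ofNat_ne_top ENNReal.one_ne_top,
        ENNReal.mul_ne_top ENNReal.ofNat_ne_top hI₀.ne⟩)
  obtain ⟨T, hT, C, hTC⟩ := h31 hc
    (ENNReal.ofReal c * (2 * 1 + 2 * ∫⁻ x in ball (0 : ℝ³) 1, ‖u₀ x‖ₑ ^ 2)).toNNReal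
  have hex : ∀ k, ∃ (v : ℝ → ℝ³ → ℝ³) (π : ℝ → ℝ³ → ℝ),
      IsLocalLeraySolution 1 (φ (k + N)) v π ∧ IsDiscretelySelfSimilar c v ∧
      nsRescalePressure c π = π ∧
      (∀ᵐ t ∂(volume.restrict (Ioo 0 T)), ∫⁻ x in ball (0 : ℝ³) 1, ‖v t x‖ₑ ^ 2 ≤ C) ∧
      (∃ G : ℝ → ℝ³ → ℝ³ →L[ℝ] ℝ³,
        HasWeakSpatialGradientOn (slab ℝ³ (Ioi 0) isOpen_Ioi) v G ∧
        ∫⁻ z in Ioo 0 T ×ˢ ball (0 : ℝ³) 1,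
          ENNReal.ofReal (frobeniusNormSq (G z.1 z.2)) ≤ C) ∧
      ∫⁻ z in Ioo 0 T ×ˢ ball (0 : ℝ³) 1, ‖π z.1 z.2‖ₑ ^ (3 / 2 : ℝ) ≤ C := fun k =>
    hTC (hφw _) (hφdiv _) (hφdss _) ((hbound k).trans_eq (ENNReal.coe_toNNReal hMfin).symm)
  choose v π hv using hex
  exact bradshawTsai2019_limit_4_3_of_local h43 hc hmeas hL2 hdiv hdss
    (w₀ := fun k => φ (k + N)) (v := v) (π := π) (T := T) (C := C)
    (fun k => hφw _) (fun k => hφdiv _) (fun k => hφdss _)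
    (hφlim.comp (tendsto_add_atTop_nat N)) (fun k => (hv k).1) (fun k => (hv k).2.1)
    (fun k => (hv k).2.2.1) hT
    (fun k => (hv k).2.2.2.1) (fun k => (hv k).2.2.2.2.1) (fun k => (hv k).2.2.2.2.2)

/-- **The historical `chae_wolf_dss_existence` from the localized ingredients** (Bradshaw–Tsai
2019, Thm 1.2, through the accepted projection `chae_wolf_dss_existence_of_bradshawTsai2019`): its
trust base is `{bradshawTsai2019_lemma_4_1, bradshawTsai2019_prop_3_1_dss,
bradshawTsai2019_limit_4_3_local}`. [cite: BradshawTsai2019, Thm 1.2] -/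
theorem chae_wolf_dss_existence_of_local_parts (h41 : bradshawTsai2019_lemma_4_1)
    (h31 : bradshawTsai2019_prop_3_1_dss) (h43 : bradshawTsai2019_limit_4_3_local) :
    chae_wolf_dss_existence :=
  chae_wolf_dss_existence_of_bradshawTsai2019
    (bradshawTsai2019_dss_existence_of_local_parts h41 h31 h43)

/-- Likewise the rendered Chae–Wolf existence statement `chaeWolf2018_dss_existence`
(Bradshaw–Tsai 2019, Comments on Thm 1.2: "a slight refinement of the main result of
[Chae–Wolf]"; accepted `chaeWolf2018_dss_existence_of_bradshawTsai2019`). [cite: BradshawTsai2019, Comments on Thm 1.2] -/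
theorem chaeWolf2018_dss_existence_of_local_parts (h41 : bradshawTsai2019_lemma_4_1)
    (h31 : bradshawTsai2019_prop_3_1_dss) (h43 : bradshawTsai2019_limit_4_3_local) :
    chaeWolf2018_dss_existence :=
  chaeWolf2018_dss_existence_of_bradshawTsai2019
    (bradshawTsai2019_dss_existence_of_local_parts h41 h31 h43)

end Literature.Analysis.FluidPDE

end
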